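import Literature.Analysis.ValidatedNumerics.TaylorModelIntegralCertParam
import Literature.Analysis.ValidatedNumerics.TaylorModelSinCos
import HarnessLib

/-!
# Kernel-checkable integral certificates for straight-line programs with `sin` / `cos` statements

Trunk T-ANA (Analysis/ValidatedNumerics); namespace `Literature.Analysis.ValidatedNumerics.PolyMP`.
Sequel of `TaylorModelIntegralCertSLP.lean` / `TaylorModelIntegralCertParam.lean` (straight-line programs for the
integrand, run on an initial stack of interval-enclosed parameters; per-panel Taylor models; the kernel-recomputed
panel / full integral enclosures and their soundness with no side hypotheses but the parameter box) and of
`TaylorModelSinCos.lean` (Taylor models of `sin ∘ g`, `cos ∘ g` by the composition algorithm `TMComp`).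

The statement type `SOp` of the first file is a closed inductive type; this file adds the two statements
"push `sin vᵢ`" and "push `cos vᵢ`" by an EXTENSION TYPE `TOp` — `base op` (any `SOp` statement, modelled by
`SOp.model` and proved sound by `SOp.tmem_model`, both reused verbatim), `sin i`, `cos i` (modelled by `tsinTM` /
`tcosTM`, sound by `tmem_sin_of_tsinTM` / `tmem_cos_of_tcosTM`) — and re-runs the generic program machinery of
Melquiond (op. cit., Sect. 3.3: a straight-line program is a list of statements, each pushing the value of an operation
whose operands are stack-relative positions of earlier results; the evaluator is generic in the operations) over
`TOp`.  Everything after the statement level — the stack invariant `StackMem`, the initial stack of constant models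
`constModels` / `stackMem_const`, the panel integral enclosures `panelIntegI` / `fullPanelsI`, the segment predicate
`FSegOK` with `fsegOK_of_tmem`, `FSegOK.append`, `FSegOK.bounds` — is imported, so the certificate theorems below are
the previous ones with `TProg` for `SProg`:

* `TOp`, `TProg`, `TOp.evalF`, `TProg.runF`, `TProg.toFunP` (semantics; `TProg.ofSProg` embeds the old programs with
  `toFunP_ofSProg`);
* `TOp.model`, **`TOp.tmem_model`**, `TProg.model`, **`TProg.stackMem_model`**, `TProg.pmodelP`, `TProg.tmem_pmodelP`;
* the certificate `certDataT`, `certCheckT`, **`integral_bounds_of_certCheckT`**: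
  `certCheckT … B … = true → BoxMem ps B → lo ≤ ∫₀^{2nh} P(ps; t) q(t) dt ≤ hi`;
* the SHARDED form `panelCheckT`, **`fsegOK_of_panelCheckT`** producing `FSegOK (p.toFunP ps) …` segments.

Parameters: `S`, `D`, `K` (series terms of the `exp` / `sin` / `cos` compositions), `Ke`, `ke` (point values of `exp`),
`Kl` (`log`), and NEW `Kt`, `kt` (terms and halvings of the π-free point values `e^{ic}` of `cisPt` at the panel-centre
value `c` of the argument register).  Problem-independent; no facts, no axioms.

## References

* G. Melquiond, *Proving bounds on real-valued functions with computations*, IJCAR 2008, LNCS 5195, 2–17: Sect. 3.3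
  (straight-line programs; the generic evaluator over a stack, relative operand positions; unary and binary
  operations of the grammar). [cite: Melquiond2008, Sect. 3.3]
* A. Mahboubi, G. Melquiond, T. Sibut-Pinote, *Formally verified approximations of definite integrals*, ITP 2016,
  LNCS 9807, 274–289: Sect. 3.2 Lemma 3, Sect. 3.3 (panel enclosures, their sum), Sect. 4.1 (programs on an initial
  stack of constants with interval hypotheses; inclusion theorem (3)). [cite: MahboubiMelquiondSibutpinote2016, Sect. 4.1]
* M. Joldeş, *Rigorous Polynomial Approximations and Applications*, PhD thesis, ENS Lyon (2011): Algorithm 2.2.8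
  (`TMComp`; `sin`, `cos` among the basic functions of Section 2.2.1) and Algorithm 2.2.10 (Taylor models of an
  expression by structural recursion). [cite: Joldes2011, Algorithm 2.2.10]
* K. Makino, M. Berz, *Taylor models and other validated functional inclusion methods*, Int. J. Pure Appl. Math. 4
  (2003) 379–456 (Taylor-model intrinsics, `sin` / `cos` eq. (2.10)–(2.11)). [cite: MakinoBerz2003, passim]
-/

open MeasureTheory intervalIntegral Set

namespace Literature.Analysis.ValidatedNumerics

namespace PolyMP

open Literature.Analysis.ValidatedNumerics.NumericsMP
open Literature.Analysis.ValidatedNumerics.ExpPoly (Poly BPoly)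
open Literature.Analysis.ValidatedNumerics.ExpPoly

/-! ### Statements and their semantics -/

/-- The statements of a straight-line program with trigonometric intrinsics: every statement of `SOp` (`base`), and
the two unary operations `sin vᵢ`, `cos vᵢ` on a stack-relative operand. [cite: Melquiond2008, Sect. 3.3] -/
inductive TOp : Type
  /-- any statement of the grammar `SOp` (`poly`, `expAff`, `neg`, `add`, `mul`, `inv`, `sqrt`, `log`, `exp`) -/
  | base (op : SOp) : TOp
  /-- push `sin vᵢ` -/
  | sin (i : ℕ) : TOp
  /-- push `cos vᵢ` -/
  | cos (i : ℕ) : TOp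
  deriving Inhabited

/-- A straight-line program with trigonometric intrinsics: its statements in execution order.
[cite: Melquiond2008, Sect. 3.3] -/
abbrev TProg : Type := List TOp

namespace TOp

/-- The real function pushed by one statement, given the stack `fs` of the functions computed so far (default `0`
past the bottom). [cite: Melquiond2008, Sect. 3.3] -/
noncomputable def evalF (fs : List (ℝ → ℝ)) : TOp → ℝ → ℝ
  | base op => op.evalF fs
  | sin i => fun t => Real.sin (getReg (fun _ => (0 : ℝ)) fs i t)
  | cos i => fun t => Real.cos (getReg (fun _ => (0 : ℝ)) fs i t)

end TOp

namespace TProg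

/-- Run a program on a stack of functions: each statement pushes its result. [cite: Melquiond2008, Sect. 3.3] -/
noncomputable def runF : TProg → List (ℝ → ℝ) → List (ℝ → ℝ)
  | [], fs => fs
  | op :: p, fs => runF p (op.evalF fs :: fs)

/-- **The real function denoted by a program with parameters**: the last result of its run on the initial stack of the
constants `ps`. [cite: MahboubiMelquiondSibutpinote2016, Sect. 4.1] -/
noncomputable def toFunP (p : TProg) (ps : List ℝ) : ℝ → ℝ :=
  getReg (fun _ => (0 : ℝ)) (p.runF (constStack ps)) 0

/-- The embedding of the programs of the previous files. [cite: Melquiond2008, Sect. 3.3] -/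
def ofSProg (p : SProg) : TProg := p.map TOp.base

/-- The embedding preserves runs. [cite: Melquiond2008, Sect. 3.3] -/
theorem runF_ofSProg : ∀ (p : SProg) (fs : List (ℝ → ℝ)), (ofSProg p).runF fs = p.runF fs
  | [], _ => rfl
  | op :: p, fs => by
      show runF (ofSProg p) ((TOp.base op).evalF fs :: fs) = SProg.runF p (op.evalF fs :: fs)
      exact runF_ofSProg p _

/-- The embedding preserves the denoted function. [cite: MahboubiMelquiondSibutpinote2016, Sect. 4.1] -/
theorem toFunP_ofSProg (p : SProg) (ps : List ℝ) : (ofSProg p).toFunP ps = p.toFunP ps := by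
  unfold toFunP SProg.toFunP
  rw [runF_ofSProg]

end TProg

/-! ### Measurability of the denoted function -/

/-- [folklore] -/
private theorem measurable_evalF_base {fs : List (ℝ → ℝ)} (hfs : ∀ i, Measurable (getReg (fun _ => (0 : ℝ)) fs i)) :
    ∀ op : SOp, Measurable (op.evalF fs)
  | SOp.poly g => (Poly.continuous_eval g).measurable
  | SOp.expAff a b => by
      show Measurable fun t : ℝ => Real.exp ((a : ℝ) + b * t)
      exact Real.measurable_exp.comp (measurable_const.add (measurable_const.mul measurable_id))
  | SOp.neg i => (hfs i).neg
  | SOp.add i j => (hfs i).add (hfs j)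
  | SOp.mul i j => (hfs i).mul (hfs j)
  | SOp.inv i => (hfs i).inv
  | SOp.sqrt i => Real.continuous_sqrt.measurable.comp (hfs i)
  | SOp.log i => Real.measurable_log.comp (hfs i)
  | SOp.exp i => Real.measurable_exp.comp (hfs i)

/-- [folklore] -/
private theorem measurable_evalF_T {fs : List (ℝ → ℝ)} (hfs : ∀ i, Measurable (getReg (fun _ => (0 : ℝ)) fs i)) :
    ∀ op : TOp, Measurable (op.evalF fs)
  | TOp.base op => measurable_evalF_base hfs op
  | TOp.sin i => Real.measurable_sin.comp (hfs i)
  | TOp.cos i => Real.measurable_cos.comp (hfs i)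

/-- [folklore] -/
private theorem measurable_getReg_cons_T {f : ℝ → ℝ} {fs : List (ℝ → ℝ)} (hf : Measurable f)
    (hfs : ∀ i, Measurable (getReg (fun _ => (0 : ℝ)) fs i)) :
    ∀ i, Measurable (getReg (fun _ => (0 : ℝ)) (f :: fs) i)
  | 0 => by simpa using hf
  | i + 1 => by simpa using hfs i

/-- [folklore] -/
private theorem measurable_runF_T : ∀ (p : TProg) (fs : List (ℝ → ℝ)),
    (∀ i, Measurable (getReg (fun _ => (0 : ℝ)) fs i)) →
      ∀ i, Measurable (getReg (fun _ => (0 : ℝ)) (p.runF fs) i)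
  | [], fs, hfs => by simpa [TProg.runF] using hfs
  | op :: p, fs, hfs => by
      rw [TProg.runF]
      exact measurable_runF_T p _ (measurable_getReg_cons_T (measurable_evalF_T hfs op) hfs)

/-- [folklore] -/
private theorem measurable_constStack_T : ∀ (ps : List ℝ) (i : ℕ),
    Measurable (getReg (fun _ => (0 : ℝ)) (constStack ps) i)
  | [], i => by rw [constStack, List.map_nil, getReg_nil]; exact measurable_const
  | c :: ps, 0 => by
      simp only [constStack, List.map_cons, getReg_cons_zero]
      exact measurable_const
  | c :: ps, i + 1 => by simpa [constStack] using measurable_constStack_T ps i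

/-- The function denoted by a program with parameters is measurable (junk values of `⁻¹`, `√`, `log` included).
[folklore] -/
private theorem TProg.measurable_toFunP (p : TProg) (ps : List ℝ) : Measurable (p.toFunP ps) := by
  unfold TProg.toFunP
  exact measurable_runF_T p (constStack ps) (measurable_constStack_T ps) 0

/-! ### The panel Taylor model of a program -/

/-- [folklore] -/
private theorem StackMem.consT {S : ℕ} {h : ℚ} {c : ℚ} {fs : List (ℝ → ℝ)} {Ws : List IPoly} (f : ℝ → ℝ)
    {W : IPoly} (hf : TMem S h (fun u => f ((c : ℝ) + u)) W) (hst : StackMem S h c fs Ws) :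
    StackMem S h c (f :: fs) (W :: Ws) := fun i => by
  cases i with
  | zero => simpa using hf
  | succ i => simpa using hst i

namespace TOp

/-- **The Taylor model pushed by one statement** on the panel `|u| ≤ h` centred at `c`, given the stack `Ws` of
register models: `SOp.model` for a `base` statement (candidates consumed as there), `tsinTM` / `tcosTM` of the operand's
register model for `sin` / `cos` (composition `TMComp` around the midpoint of the operand's constant coefficient, the
point values `cos c`, `sin c` from `cisPt S Kt kt`). [cite: Joldes2011, Algorithm 2.2.10] -/
def model (S : ℕ) (h : ℚ) (D K Ke ke Kl Kt kt : ℕ) (c : ℚ) (Ws : List IPoly) :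
    TOp → List (List ℤ × ℕ) → WExpr.MRes
  | base op, cs => op.model S h D K Ke ke Kl c Ws cs
  | sin i, cs =>
      let t := tsinTM S h D K Kt kt (getReg [] Ws i)
      ⟨t.1, cs, t.2⟩
  | cos i, cs =>
      let t := tcosTM S h D K Kt kt (getReg [] Ws i)
      ⟨t.1, cs, t.2⟩

/-- **Soundness of `TOp.model`** under the stack invariant. [cite: Joldes2011, Algorithm 2.2.10] -/
theorem tmem_model {S : ℕ} (hS : 0 < S) {h : ℚ} (h0 : 0 ≤ h) {D K Ke ke Kl Kt kt : ℕ} (c : ℚ)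
    {fs : List (ℝ → ℝ)} {Ws : List IPoly} (hst : StackMem S h c fs Ws) :
    ∀ (op : TOp) (cs : List (List ℤ × ℕ)), (op.model S h D K Ke ke Kl Kt kt c Ws cs).ok = true →
      TMem S h (fun u => op.evalF fs ((c : ℝ) + u)) (op.model S h D K Ke ke Kl Kt kt c Ws cs).P
  | base op, cs, hok => SOp.tmem_model hS h0 c hst op cs hok
  | sin i, cs, hok => by
      simp only [model] at hok ⊢
      exact tmem_sin_of_tsinTM hS h0 (hst i) hok
  | cos i, cs, hok => by
      simp only [model] at hok ⊢
      exact tmem_cos_of_tcosTM hS h0 (hst i) hok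

end TOp

namespace TProg

/-- **The register models after running a program** on the panel centred at `c` from the stack `Ws`, with the
conjunctive acceptance flag (candidates consumed in program order). [cite: Melquiond2008, Sect. 3.3] -/
def model (S : ℕ) (h : ℚ) (D K Ke ke Kl Kt kt : ℕ) (c : ℚ) :
    TProg → List IPoly → List (List ℤ × ℕ) → List IPoly × Bool
  | [], Ws, _ => (Ws, true)
  | op :: p, Ws, cs =>
      let r := op.model S h D K Ke ke Kl Kt kt c Ws cs
      let s := model S h D K Ke ke Kl Kt kt c p (r.P :: Ws) r.rest
      (s.1, r.ok && s.2)

/-- **Soundness of `TProg.model`**: the stack invariant is preserved by an accepted run.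
[cite: Melquiond2008, Sect. 3.3] -/
theorem stackMem_model {S : ℕ} (hS : 0 < S) {h : ℚ} (h0 : 0 ≤ h) {D K Ke ke Kl Kt kt : ℕ} (c : ℚ) :
    ∀ (p : TProg) {fs : List (ℝ → ℝ)} {Ws : List IPoly}, StackMem S h c fs Ws →
      ∀ cs : List (List ℤ × ℕ), (p.model S h D K Ke ke Kl Kt kt c Ws cs).2 = true →
        StackMem S h c (p.runF fs) (p.model S h D K Ke ke Kl Kt kt c Ws cs).1
  | [], _, _, hst, cs, _ => by simpa [model, runF] using hst
  | op :: p, fs, Ws, hst, cs, hok => by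
      simp only [model, Bool.and_eq_true] at hok
      rw [runF, model]
      exact stackMem_model hS h0 c p
        (hst.consT (op.evalF fs) (TOp.tmem_model hS h0 c hst op cs hok.1 (D := D) (K := K) (Ke := Ke)
          (ke := ke) (Kl := Kl) (Kt := Kt) (kt := kt))) _ hok.2

/-- **The panel Taylor model of `u ↦ P(ps; c + u)`**: the top register model after the run on the initial stack of
constant models of the parameter box, with its acceptance flag. [cite: MahboubiMelquiondSibutpinote2016, Sect. 4.1] -/
def pmodelP (S : ℕ) (h : ℚ) (D K Ke ke Kl Kt kt : ℕ) (c : ℚ) (p : TProg) (B : PBox) (cs : List (List ℤ × ℕ)) :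
    IPoly × Bool :=
  let s := p.model S h D K Ke ke Kl Kt kt c (constModels S B) cs
  (getReg [] s.1 0, s.2)

/-- **Soundness of `pmodelP`**: for every parameter vector of the box, an accepted model encloses `u ↦ P(ps; c + u)`
on `|u| ≤ h`. [cite: MahboubiMelquiondSibutpinote2016, Sect. 4.1] -/
theorem tmem_pmodelP {S : ℕ} (hS : 0 < S) {h : ℚ} (h0 : 0 ≤ h) {D K Ke ke Kl Kt kt : ℕ} (c : ℚ) (p : TProg)
    {ps : List ℝ} {B : PBox} (hB : BoxMem ps B) (cs : List (List ℤ × ℕ))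
    (hok : (p.pmodelP S h D K Ke ke Kl Kt kt c B cs).2 = true) :
    TMem S h (fun u => p.toFunP ps ((c : ℝ) + u)) (p.pmodelP S h D K Ke ke Kl Kt kt c B cs).1 := by
  unfold pmodelP at hok ⊢
  unfold toFunP
  exact stackMem_model hS h0 c p (stackMem_const S h c hB) cs hok 0

end TProg

/-! ### The certificate -/

/-- The panel data `(W_j, pw_j)` of panels `j₀, j₀+1, …` with its conjunctive acceptance flag; one candidate list per
panel. [folklore] -/
def certDataT (S : ℕ) (h : ℚ) (D K Ke ke Kl Kt kt : ℕ) (p : TProg) (B : PBox) :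
    List (List (List ℤ × ℕ)) → ℕ → List (IPoly × Poly) × Bool
  | [], _ => ([], true)
  | cs :: css, j =>
      let r := p.pmodelP S h D K Ke ke Kl Kt kt (panelCentre h j) B cs
      let t := certDataT S h D K Ke ke Kl Kt kt p B css (j + 1)
      ((r.1, midPoly S r.1) :: t.1, r.2 && t.2)

/-- [folklore] -/
private theorem length_certDataT (S : ℕ) (h : ℚ) (D K Ke ke Kl Kt kt : ℕ) (p : TProg) (B : PBox) :
    ∀ (css : List (List (List ℤ × ℕ))) (j : ℕ), (certDataT S h D K Ke ke Kl Kt kt p B css j).1.length = css.length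
  | [], _ => rfl
  | _ :: css, j => by simp [certDataT, length_certDataT S h D K Ke ke Kl Kt kt p B css (j + 1)]

/-- [folklore] -/
private theorem tmem_certDataT {S : ℕ} (hS : 0 < S) {h : ℚ} (h0 : 0 ≤ h) {D K Ke ke Kl Kt kt : ℕ} (p : TProg)
    {ps : List ℝ} {B : PBox} (hB : BoxMem ps B) :
    ∀ (css : List (List (List ℤ × ℕ))) (j₀ : ℕ), (certDataT S h D K Ke ke Kl Kt kt p B css j₀).2 = true →
      ∀ i : Fin (certDataT S h D K Ke ke Kl Kt kt p B css j₀).1.length,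
        TMem S h (fun u => p.toFunP ps ((panelCentre h (j₀ + (i : ℕ)) : ℝ) + u))
          ((certDataT S h D K Ke ke Kl Kt kt p B css j₀).1.get i).1
  | [], _, _, i => i.elim0
  | cs :: css, j₀, hok, ⟨0, _⟩ => by
      simp only [certDataT, Bool.and_eq_true] at hok
      simpa [certDataT] using TProg.tmem_pmodelP hS h0 (panelCentre h j₀) p hB cs hok.1
  | cs :: css, j₀, hok, ⟨i + 1, hi⟩ => by
      simp only [certDataT, Bool.and_eq_true] at hok
      have hi' : i < (certDataT S h D K Ke ke Kl Kt kt p B css (j₀ + 1)).1.length := by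
        simpa [certDataT] using hi
      have ih := tmem_certDataT hS h0 p hB css (j₀ + 1) hok.2 ⟨i, hi'⟩
      have e : j₀ + 1 + i = j₀ + (i + 1) := by omega
      simpa [certDataT, e] using ih

/-- **The certificate** for `lo ≤ ∫₀^{2nh} P(ps; t) q(t) dt ≤ hi` (`n = css.length`), uniformly over the parameter box
`B`: positivity of `S` and `h`, every panel model accepted, and the kernel enclosure inside `[lo·S, hi·S]`. [folklore] -/
def certCheckT (S : ℕ) (h : ℚ) (D K Ke ke Kl Kt kt : ℕ) (p : TProg) (B : PBox) (q : Poly)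
    (css : List (List (List ℤ × ℕ))) (lo hi : ℚ) : Bool :=
  let d := certDataT S h D K Ke ke Kl Kt kt p B css 0
  let I := fullPanelsI S h q d.1 0
  decide (0 < S) && decide (0 < h) && d.2 && decide (lo * S ≤ (I.lo : ℚ)) && decide ((I.hi : ℚ) ≤ hi * S)

/-- **Soundness of the certificate**: the piecewise polynomial integral enclosure re-computed by the kernel from
untrusted data bounds the integral for EVERY parameter vector of the box — the only hypothesis is the box membership
of the parameters. [cite: MahboubiMelquiondSibutpinote2016, Sect. 4.1] -/
theorem integral_bounds_of_certCheckT {S : ℕ} {h : ℚ} {D K Ke ke Kl Kt kt : ℕ} {p : TProg} {B : PBox} {q : Poly}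
    {css : List (List (List ℤ × ℕ))} {lo hi : ℚ}
    (hc : certCheckT S h D K Ke ke Kl Kt kt p B q css lo hi = true) {ps : List ℝ} (hB : BoxMem ps B) :
    (lo : ℝ) ≤ ∫ t in (0 : ℝ)..(2 * css.length * (h : ℝ)), p.toFunP ps t * Poly.eval q t ∧
      ∫ t in (0 : ℝ)..(2 * css.length * (h : ℝ)), p.toFunP ps t * Poly.eval q t ≤ (hi : ℝ) := by
  unfold certCheckT at hc
  simp only [Bool.and_eq_true, decide_eq_true_eq] at hc
  obtain ⟨⟨⟨⟨hS, h0⟩, hok⟩, hlo⟩, hhi⟩ := hc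
  have hD := tmem_certDataT hS h0.le p hB css 0 hok (D := D) (K := K) (Ke := Ke) (ke := ke) (Kl := Kl)
    (Kt := Kt) (kt := kt)
  simp only [Nat.zero_add] at hD
  obtain ⟨hm, -⟩ := mem_fullPanelsI_of_tmem hS h0.le (TProg.measurable_toFunP p ps) q
    (certDataT S h D K Ke ke Kl Kt kt p B css 0).1 0 (fun i => by simpa using hD i)
  rw [length_certDataT] at hm
  have e1 : (2 * ((0 : ℕ) : ℝ) * (h : ℝ)) = 0 := by simp
  have e2 : (2 * (((0 : ℕ) : ℝ) + (css.length : ℕ)) * (h : ℝ)) = 2 * css.length * (h : ℝ) := by simp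
  rw [e1, e2] at hm
  obtain ⟨h1, h2⟩ := hm
  have hSr : (0 : ℝ) < S := by exact_mod_cast hS
  have hloR : (lo : ℝ) * S ≤ ((fullPanelsI S h q (certDataT S h D K Ke ke Kl Kt kt p B css 0).1 0).lo : ℝ) := by
    exact_mod_cast hlo
  have hhiR : ((fullPanelsI S h q (certDataT S h D K Ke ke Kl Kt kt p B css 0).1 0).hi : ℝ) ≤ (hi : ℝ) * S := by
    exact_mod_cast hhi
  exact ⟨le_of_mul_le_mul_right (hloR.trans h1) hSr, le_of_mul_le_mul_right (h2.trans hhiR) hSr⟩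

/-! ### Sharded certificates

One kernel check per panel; the certified object is a function segment `FSegOK (p.toFunP ps) q S a b lo hi` of
`TaylorModelIntegralCertSLP.lean`, so the gluing (`FSegOK.append`) and the final bounds (`FSegOK.bounds`) are literally
those. -/

/-- **The per-panel certificate** for a program with parameters: positivity of `S` and `h`, the panel model accepted,
and the kernel's panel enclosure inside `[plo, phi]`. [folklore] -/
def panelCheckT (S : ℕ) (h : ℚ) (D K Ke ke Kl Kt kt : ℕ) (p : TProg) (B : PBox) (q : Poly) (j : ℕ)
    (cs : List (List ℤ × ℕ)) (plo phi : ℤ) : Bool :=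
  let r := p.pmodelP S h D K Ke ke Kl Kt kt (panelCentre h j) B cs
  let I := panelIntegI S h r.1 (midPoly S r.1) (recenter q h j)
  decide (0 < S) && decide (0 < h) && r.2 && decide (plo ≤ I.lo) && decide (I.hi ≤ phi)

/-- **Soundness of the per-panel certificate**, for every parameter vector of the box.
[cite: MahboubiMelquiondSibutpinote2016, Sect. 3.2 Lemma 3, Sect. 4.1] -/
theorem fsegOK_of_panelCheckT {S : ℕ} {h : ℚ} {D K Ke ke Kl Kt kt : ℕ} {p : TProg} {B : PBox} {q : Poly} {j : ℕ}
    {cs : List (List ℤ × ℕ)} {plo phi : ℤ} (hc : panelCheckT S h D K Ke ke Kl Kt kt p B q j cs plo phi = true)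
    {ps : List ℝ} (hB : BoxMem ps B) :
    FSegOK (p.toFunP ps) q S (panelLeft h j) (panelLeft h (j + 1)) plo phi := by
  unfold panelCheckT at hc
  simp only [Bool.and_eq_true, decide_eq_true_eq] at hc
  obtain ⟨⟨⟨⟨hS, h0⟩, hok⟩, hlo⟩, hhi⟩ := hc
  exact fsegOK_of_tmem hS h0 (TProg.measurable_toFunP p ps) q j
    (TProg.tmem_pmodelP hS h0.le (panelCentre h j) p hB cs hok) hlo hhi

end PolyMP

end Literature.Analysis.ValidatedNumerics
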